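import Summits.HodgeConjecture.HodgeConjecture.Theorems.MarkmanPartnerTransportPicardThreeK3SquaresZeta9TypePicardTen
import HarnessLib

/-!
# Route MarkmanPartnerTransport · crux `PicardThreeK3Squares` (stmt-HodgeConjecture-19652) —
# the ζ₉ type FORCES Picard number 10: HC⁴(S ⊗ S) from the conjugacy alone

Cell hodge-nonav, crux #4, INDEX row M-θ₉ (prover seat hodge-nonav-19652-p1 gen 12; `--supports
stmt-HodgeConjecture-19652`, helper). `exists_zeta9Type_hodgeConjectureFor_square_of_picard_ten`
(`…Zeta9TypePicardTen`) still carries the hypothesis `ρ(S) = 10`; here it is DERIVED (fact-free) for every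
marked projective K3 surface whose endomorphism `t` (rational, type-preserving, killing `N¹(S)`) is
conjugate by a rational isometry `σ` of `Λ_ℚ` to the ζ₉ model `θ_ℂ`:
* `eigenvalue_ne_zero_of_zeta9Model` — the `(2,0)`-eigenvalue `ev` of `t` is non-zero: if `ev = 0` then
  `σx ∈ ker θ_ℂ`, the self-adjoint rational projector `P_T = 3θ - θ³` sends every rational vector into
  `(σx)^⊥`, where `θ` vanishes by the `θ`-genericity of `σx` (`generic_and_posKernel_of_marking`, Lefschetz
  `(1,1)` on `S`), so `θ = θ ∘ P_T = 0`, contradicting `θ_ℂ y₀ = 2cos(2π/9)·y₀ ≠ 0`;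
* `exists_mem_algebraicClasses_of_ratCast_mem_ker` — every RATIONAL `q ∈ ker θ_ℂ` is `ση(d)` for an
  algebraic divisor class `d = η⁻¹σ⁻¹q` (rational; of type `(1,1)` since `(q . σx) = ev⁻¹(θq . σx) = 0` and
  likewise against `x̄`, `σ` being real as a product of lattice reflections; Lefschetz `(1,1)`);
* `ker_thetaC_le_span_ratCast` — `ker θ_ℂ = ker(g³ - 1)` is SPANNED by the rational vectors
  `⅓(g⁶ + g³ + 1)eᵢ` (no base-change theory);
* **`finrank_algebraicClasses_eq_ten_of_zeta9Model`** — hence `ρ(S) = 10`;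
* **`exists_zeta9Type_hodgeConjectureFor_square_of_conj`** — ∃ ζ₉ datum such that EVERY marked projective
  K3 surface with an endomorphism `t` (rational, type-preserving, killing `N¹`, image `⊥ N¹`) conjugate by a
  rational isometry to `θ_ℂ` has `HodgeConjectureFor 4 (S ⊗ S)` — no Picard number, no annihilating
  polynomial, no generation clause. CONDITIONAL on {`Buskin2019_hodgeIsometry_algebraic`,
  `VanGeemenSchuett2025_zeta9_cycleOnOpenPeriodSet`, `Huybrechts_K3_marking_exists`,
  `Buskin2019_hodgeConjectureFor_square_of_CM`}; credits nothing; HC is NOT proved here.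

No definition, no sorry. References: van Geemen–Schütt, Forum Math. Sigma 13 (2025) e2, Thm. 1.1 (9),
§2.1, §2.4–2.6, §5.6; Huybrechts, *Lectures on K3 Surfaces*, Ch. 1 Prop. 3.5, Ch. 3 §3.2–3.3; Buskin,
J. reine angew. Math. 755 (2019), Thm. 1.1 and §6.2.
-/

set_option linter.dupNamespace false

noncomputable section

namespace Summit.HodgeConjecture.HodgeConjecture.Theorems.MarkmanPartnerTransport.RMTypeOrbit

open CategoryTheory MonoidalCategory Polynomial
open Literature.AlgebraicGeometry Literature.AlgebraicGeometry.Motives Literature.AlgebraicGeometry.HodgeTheory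
open Literature.AlgebraicGeometry.Surfaces Literature.LinearAlgebra.QuadraticForm
open Literature.AlgebraicTopology.SingularHomology
open Summit.HodgeConjecture.HodgeConjecture.Theorems.NikulinTwinTransport
open Summit.HodgeConjecture.HodgeConjecture.Theorems.MarkmanPartnerTransport.IsogenyInvariance
open Summit.HodgeConjecture.HodgeConjecture.Theorems.MarkmanPartnerTransport.RMTypeDescent

/-- `MarkedK3[S, η, p, x]`: VERBATIM the `let MarkedK3 := …` binder of the route declaration
`PicardThreeK3Squares` (as in `…RMTypeDescent`). Local notation only. -/
local notation3 (prettyPrint := false) "MarkedK3[" S ", " η ", " p ", " x "]" =>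
  (p ≠ 0 ∧ (IsIntegralClass p ∧
    (∀ q : complexBetti S (2 * 2), IsIntegralClass q → ∃ n : ℤ, q = n • p) ∧
    (∀ c : complexBetti S (2 * 1), IsIntegralClass c ↔ ∃ v : K3Index → ℤ, η c = fun i => (v i : ℂ)) ∧
    (∀ a b : complexBetti S (2 * 1),
      cupProduct (rfl : 2 * 1 + 2 * 1 = 2 * 2) a b = k3Form (η a) (η b) • p) ∧
    IsOfHodgeType 2 S (2 * 1) 2 0 (LinearEquiv.symm η x) ∧
    (∀ τ : complexBetti S (2 * 1), IsOfHodgeType 2 S (2 * 1) 2 0 τ →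
      ∃ t : ℂ, τ = t • LinearEquiv.symm η x)) ∧
    (k3Form x x = 0 ∧ 0 < (k3Form (star x) x).re ∧
      ∃ u : K3Index → ℤ, k3Form (fun i => (u i : ℂ)) x = 0 ∧ 0 < ∑ i, ∑ j, u i * k3Gram i j * u j))

/-- `Zeta9Model[g, y₀, θ]`: VERBATIM the datum conjuncts of the named fact
`VanGeemenSchuett2025_zeta9_cycleOnOpenPeriodSet` (as in `…Zeta9Type`). Local notation only. -/
local notation3 (prettyPrint := false) "Zeta9Model[" g ", " y₀ ", " θ "]" =>
  ((∀ a b : K3Index → ℂ, k3Form (g a) (g b) = k3Form a b) ∧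
    (∀ v : K3Index → ℤ, ∃ w : K3Index → ℤ,
      g (fun i => ((v i : ℤ) : ℂ)) = fun i => ((w i : ℤ) : ℂ)) ∧
    g ^ 9 = 1 ∧
    Module.finrank ℂ (LinearMap.ker (g ^ 3 - 1)) = 10 ∧
    k3Form y₀ y₀ = 0 ∧ 0 < (k3Form (star y₀) y₀).re ∧
    g y₀ = Complex.exp (2 * Real.pi * Complex.I / 9) • y₀ ∧
    (∀ y : K3Index → ℂ, thetaC θ y =
      (1 / 3 : ℂ) • ((2 : ℂ) • g y + (2 : ℂ) • (g ^ 8) y - (g ^ 2) y - (g ^ 4) y - (g ^ 5) y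
        - (g ^ 7) y)))

variable {g : Module.End ℂ (K3Index → ℂ)} {y₀ : K3Index → ℂ} {θ : Matrix K3Index K3Index ℚ}

/-- `θ_ℂ = θ_ℂ ∘ (3θ_ℂ - θ_ℂ³)` for a ζ₉ datum (the quartic identity). [folklore] -/
theorem thetaC_eq_mul_proj_of_zeta9Model (hZ : Zeta9Model[g, y₀, θ]) :
    thetaC θ = thetaC θ * ((3 : ℂ) • thetaC θ - thetaC θ ^ 3) := by
  have h := thetaC_quartic_of_zeta9Model hZ
  rw [mul_sub, mul_smul_comm, ← sq, ← pow_succ', ← sub_eq_zero]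
  have e : thetaC θ - ((3 : ℂ) • thetaC θ ^ 2 - thetaC θ ^ (3 + 1)) =
      thetaC θ ^ (3 + 1) - (3 : ℂ) • thetaC θ ^ 2 + thetaC θ := by abel
  rw [e]
  exact h

/-- `P_T = 3θ_ℂ - θ_ℂ³` maps rational vectors to rational vectors. [folklore] -/
theorem proj_ratCast (θ : Matrix K3Index K3Index ℚ) (v : K3Index → ℚ) :
    ((3 : ℂ) • thetaC θ - thetaC θ ^ 3) (fun i => (v i : ℂ)) =
      fun i => (((3 : ℚ) • θ.mulVec v - θ.mulVec (θ.mulVec (θ.mulVec v))) i : ℂ) := by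
  rw [LinearMap.sub_apply, LinearMap.smul_apply, pow_succ, pow_two, Module.End.mul_apply,
    Module.End.mul_apply, thetaC_ratCast, thetaC_ratCast, thetaC_ratCast]
  funext i
  simp only [Pi.smul_apply, Pi.sub_apply, smul_eq_mul, Rat.cast_sub, Rat.cast_mul, Rat.cast_ofNat]

/-- `P_T = 3θ_ℂ - θ_ℂ³` is `k3Form`-self-adjoint for a ζ₉ datum. [folklore] -/
theorem proj_selfAdjoint (hZ : Zeta9Model[g, y₀, θ]) (a b : K3Index → ℂ) :
    k3Form (((3 : ℂ) • thetaC θ - thetaC θ ^ 3) a) b = k3Form a (((3 : ℂ) • thetaC θ - thetaC θ ^ 3) b) := by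
  have hθsa : ∀ a b : K3Index → ℂ, k3Form (thetaC θ a) b = k3Form a (thetaC θ b) :=
    selfAdjoint_of_zeta9Model hZ.1 hZ.2.2.1 hZ.2.2.2.2.2.2.2
  simp only [LinearMap.sub_apply, LinearMap.smul_apply, k3Form_sub_left, k3Form_smul_left, k3Form_sub_right',
    k3Form_smul_right, k3Form_pow_selfAdjoint hθsa, hθsa]

variable {S : SchemeOver ℂ}

/-- **The `(2,0)`-eigenvalue of an endomorphism conjugate to the ζ₉ model is non-zero.** For a marked
projective K3 surface `(S, η, p, x)`, an endomorphism `t` killing `N¹(S)` with `t(η⁻¹x) = ev·η⁻¹x`, and a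
rational isometry `σ` with `σηt = θ_ℂση`: `ev ≠ 0`. Otherwise `σx ∈ ker θ_ℂ`, the self-adjoint rational
projector `P_T = 3θ - θ³` sends every rational vector into `(σx)^⊥`, where `θ` vanishes by the
`θ`-genericity of `σx` (`generic_and_posKernel_of_marking`, Lefschetz `(1,1)`), so `θ = θ ∘ P_T = 0`,
contradicting `θ_ℂ y₀ = 2cos(2π/9)·y₀ ≠ 0`. Fact-free.
[cite: GeemenSchutt2023, §2.1 and §2.4] [cite: Huybrechts2016K3, Ch. 3 §3.2] -/
theorem eigenvalue_ne_zero_of_zeta9Model (hZ : Zeta9Model[g, y₀, θ]) (hS : IsK3Surface S)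
    (η : complexBetti S (2 * 1) ≃ₗ[ℂ] (K3Index → ℂ)) (p : complexBetti S (2 * 2)) (x : K3Index → ℂ)
    (hM : MarkedK3[S, η, p, x])
    (t : complexBetti S (2 * 1) →ₗ[ℂ] complexBetti S (2 * 1))
    (ht_N : ∀ d ∈ algebraicClasses S 1, t d = 0)
    (σ : Module.End ℂ (K3Index → ℂ)) (hσ : ∀ a b, k3Form (σ a) (σ b) = k3Form a b)
    (hσrat : ∀ v : K3Index → ℤ, ∃ w : K3Index → ℚ, σ (fun i => (v i : ℂ)) = fun i => (w i : ℂ))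
    (hconj : ∀ c : complexBetti S (2 * 1), σ (η (t c)) = thetaC θ (σ (η c)))
    {ev : ℂ} (hev : t (η.symm x) = ev • η.symm x) : ev ≠ 0 := by
  classical
  intro hev0
  obtain ⟨hgenσ, -⟩ := generic_and_posKernel_of_marking hS η p x hM t ht_N σ hσ hσrat hconj
  -- `θ (σ x) = 0`
  have hθσx : thetaC θ (σ x) = 0 := by
    have h := hconj (η.symm x)
    rw [hev, hev0, zero_smul, map_zero, map_zero, LinearEquiv.apply_symm_apply] at h
    exact h.symm
  set P : Module.End ℂ (K3Index → ℂ) := (3 : ℂ) • thetaC θ - thetaC θ ^ 3 with hP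
  have hPσx : P (σ x) = 0 := by
    rw [hP, LinearMap.sub_apply, LinearMap.smul_apply, pow_succ, Module.End.mul_apply, hθσx, smul_zero,
      map_zero, sub_zero]
  -- `θ ∘ P` vanishes on every rational vector
  have hθP : ∀ v : K3Index → ℚ, thetaC θ (P (fun i => (v i : ℂ))) = 0 := by
    intro v
    rw [hP, proj_ratCast θ v, thetaC_ratCast]
    have h0 : θ.mulVec ((3 : ℚ) • θ.mulVec v - θ.mulVec (θ.mulVec (θ.mulVec v))) = 0 := by
      refine hgenσ _ ?_
      rw [← proj_ratCast θ v, ← hP, proj_selfAdjoint hZ, hPσx, k3Form_zero_right]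
    rw [h0]
    funext i
    simp
  -- hence `θ = θ ∘ P = 0`
  have hθ0 : thetaC θ = 0 := by
    rw [thetaC_eq_mul_proj_of_zeta9Model hZ, ← hP]
    refine (Pi.basisFun ℂ K3Index).ext fun i => ?_
    rw [Module.End.mul_apply, LinearMap.zero_apply, Pi.basisFun_apply]
    have h := hθP (Pi.single i 1)
    have hcast : (fun j => ((Pi.single i (1 : ℚ) : K3Index → ℚ) j : ℂ)) = Pi.single i (1 : ℂ) := by
      funext j
      by_cases hij : j = i
      · subst hij; simp
      · simp [hij]
    rw [hcast] at h
    exact h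
  -- contradiction with `θ y₀ = e₀ y₀ ≠ 0`
  have hy := thetaC_apply_eq_of_zeta9Model hZ
  rw [hθ0, LinearMap.zero_apply] at hy
  have hy0 : y₀ ≠ 0 := ne_zero_of_star_self_re_pos hZ.2.2.2.2.2.1
  have he₀ : ((2 * Real.cos (2 * Real.pi / 9) : ℝ) : ℂ) ≠ 0 := by
    exact_mod_cast two_mul_cos_two_pi_div_nine_pos.ne'
  exact hy0 ((smul_eq_zero.1 hy.symm).resolve_left he₀)

/-- A rational isometry of `Λ_ℂ` (a product of reflections along lattice vectors) is a REAL operator.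
[cite: Huybrechts2016K3, Ch. 6 §1.1] -/
theorem star_apply_ratIsometry (σ : Module.End ℂ (K3Index → ℂ))
    (hσ : ∀ a b, k3Form (σ a) (σ b) = k3Form a b)
    (hσrat : ∀ v : K3Index → ℤ, ∃ w : K3Index → ℚ, σ (fun i => (v i : ℂ)) = fun i => (w i : ℂ))
    (y : K3Index → ℂ) : star (σ y) = σ (star y) := by
  obtain ⟨l, -, -, rfl⟩ := exists_eq_prod_k3ReflectionC σ hσ hσrat
  clear hσ hσrat
  induction l generalizing y with
  | nil => simp
  | cons v l ih =>
    rw [List.map_cons, List.prod_cons, Module.End.mul_apply, Module.End.mul_apply, star_k3ReflectionC, ih]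

/-- **Every rational vector of `ker θ_ℂ` is the image of an algebraic divisor class** under `A = σ ∘ η`,
for a marked projective K3 surface whose endomorphism `t` (type-preserving, killing `N¹(S)`) is conjugate by
the rational isometry `σ` to the ζ₉ model: `d = η⁻¹σ⁻¹q` is rational, cup-orthogonal to `η⁻¹x` and to its
conjugate (`(q . σx) = ev⁻¹(θq . σx) = 0`, `ev ≠ 0`, `σ` real), hence of type `(1,1)` and algebraic by
Lefschetz `(1,1)`. Fact-free (Lefschetz `(1,1)` is a tree theorem).
[cite: Huybrechts2016K3, Ch. 1 Prop. 3.5 and Ch. 3 §3.2] [cite: Buskin2019, §6.2] -/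
theorem exists_mem_algebraicClasses_of_ratCast_mem_ker (hZ : Zeta9Model[g, y₀, θ]) (hS : IsK3Surface S)
    (η : complexBetti S (2 * 1) ≃ₗ[ℂ] (K3Index → ℂ)) (p : complexBetti S (2 * 2)) (x : K3Index → ℂ)
    (hM : MarkedK3[S, η, p, x])
    (t : complexBetti S (2 * 1) →ₗ[ℂ] complexBetti S (2 * 1))
    (ht_typ : ∀ (i j : ℕ) (y : complexBetti S (2 * 1)),
      IsOfHodgeType 2 S (2 * 1) i j y → IsOfHodgeType 2 S (2 * 1) i j (t y))
    (ht_N : ∀ d ∈ algebraicClasses S 1, t d = 0)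
    (σ : Module.End ℂ (K3Index → ℂ)) (hσ : ∀ a b, k3Form (σ a) (σ b) = k3Form a b)
    (hσrat : ∀ v : K3Index → ℤ, ∃ w : K3Index → ℚ, σ (fun i => (v i : ℂ)) = fun i => (w i : ℂ))
    (hconj : ∀ c : complexBetti S (2 * 1), σ (η (t c)) = thetaC θ (σ (η c)))
    (q : K3Index → ℚ) (hq : thetaC θ (fun i => (q i : ℂ)) = 0) :
    ∃ d ∈ algebraicClasses S 1, σ (η d) = fun i => (q i : ℂ) := by
  classical
  have hHT : Huybrechts_K3_hodgeTypes_H2 := Huybrechts_K3_hodgeTypes_H2_holds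
  have hθsa : ∀ a b : K3Index → ℂ, k3Form (thetaC θ a) b = k3Form a (thetaC θ b) :=
    selfAdjoint_of_zeta9Model hZ.1 hZ.2.2.1 hZ.2.2.2.2.2.2.2
  obtain ⟨hp0, ⟨hpint, hpgen, hηint, hηcup, h20, hline⟩, hPer⟩ := hM
  have hx0 : η.symm x ≠ 0 := fun h0 =>
    ne_zero_of_star_self_re_pos hPer.2.1 (by simpa using congrArg η h0)
  obtain ⟨ev, hev⟩ := hline (t (η.symm x)) (ht_typ 2 0 _ h20)
  have hev0 : ev ≠ 0 := eigenvalue_ne_zero_of_zeta9Model hZ hS η p x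
    ⟨hp0, ⟨hpint, hpgen, hηint, hηcup, h20, hline⟩, hPer⟩ t ht_N σ hσ hσrat hconj hev
  -- `θ (σ x) = ev • σ x`
  have heig : thetaC θ (σ x) = ev • σ x := by
    have h := hconj (η.symm x)
    rw [hev, map_smul, LinearEquiv.apply_symm_apply, map_smul] at h
    exact h.symm
  -- the inverse isometry and the candidate class
  obtain ⟨σ', hσσ', -, -, hσ'rat⟩ := exists_inverse_ratIsometry σ hσ hσrat
  set qC : K3Index → ℂ := fun i => (q i : ℂ) with hqC
  set d : complexBetti S (2 * 1) := η.symm (σ' qC) with hd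
  have hAd : σ (η d) = qC := by rw [hd, LinearEquiv.apply_symm_apply, hσσ']
  -- `d` is rational
  have hd_rat : IsRationalClass d := by
    obtain ⟨w, hw⟩ := ratEnd_ratCast σ' hσ'rat q
    exact (isRationalClass_iff_of_marking hS η hηint d).2 ⟨w, by rw [hd, LinearEquiv.apply_symm_apply, hw]⟩
  -- `(q . σx) = 0` and `(q . conj σx) = 0`
  have horth : k3Form qC (σ x) = 0 := by
    have h := hθsa qC (σ x)
    rw [hq, k3Form_zero_left, heig, k3Form_smul_right] at h
    exact (mul_eq_zero.1 h.symm).resolve_left hev0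
  have horth' : k3Form qC (star (σ x)) = 0 := by
    have h := hθsa qC (star (σ x))
    rw [hq, k3Form_zero_left, thetaC_star, heig, star_smul, k3Form_smul_right] at h
    exact (mul_eq_zero.1 h.symm).resolve_left (star_ne_zero.2 hev0)
  -- hence `d` is of type `(1,1)`
  obtain ⟨-, -, h3⟩ := hHT S hS (η.symm x) h20 hx0
  have hcup1 : cupProduct (rfl : 2 * 1 + 2 * 1 = 2 * 2) d (η.symm x) = 0 := by
    rw [hηcup, hd, LinearEquiv.apply_symm_apply, LinearEquiv.apply_symm_apply, ← hσ (σ' qC) x, hσσ', horth,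
      zero_smul]
  have hcup2 :
      cupProduct (rfl : 2 * 1 + 2 * 1 = 2 * 2) d (conjClass (ComplexPoints S) (2 * 1) (η.symm x)) = 0 := by
    rw [conjClass_marking_symm η hηint x, hηcup, hd, LinearEquiv.apply_symm_apply,
      LinearEquiv.apply_symm_apply, ← hσ (σ' qC) (star x), hσσ', ← star_apply_ratIsometry σ hσ hσrat x,
      horth', zero_smul]
  have h11 : IsOfHodgeType 2 S (2 * 1) 1 1 d := (h3 d).2 ⟨hcup1, hcup2⟩
  exact ⟨d, lefschetzOneOne_rational_holds hS.1 d hd_rat h11, hAd⟩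

/-- Powers of an integral endomorphism are integral. [folklore] -/
theorem pow_apply_intCast_of_intCast {g : Module.End ℂ (K3Index → ℂ)}
    (hgint : ∀ v : K3Index → ℤ, ∃ w : K3Index → ℤ, g (fun i => ((v i : ℤ) : ℂ)) = fun i => ((w i : ℤ) : ℂ))
    (k : ℕ) (v : K3Index → ℤ) : ∃ w : K3Index → ℤ, (g ^ k) (fun i => ((v i : ℤ) : ℂ)) = fun i => ((w i : ℤ) : ℂ) := by
  induction k with
  | zero => exact ⟨v, by simp⟩
  | succ k ih =>
    obtain ⟨w, hw⟩ := ih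
    obtain ⟨w', hw'⟩ := hgint w
    exact ⟨w', by rw [pow_succ', Module.End.mul_apply, hw, hw']⟩

/-- **`ker θ_ℂ` is spanned by rational vectors** (ζ₉ datum): `ker θ_ℂ = ker(g³ - 1)` is the image of the
projector `⅓(g⁶ + g³ + 1)`, which maps the standard basis to rational vectors of `ker θ_ℂ`. No base-change
theory is used. [folklore] -/
theorem ker_thetaC_le_span_ratCast (hZ : Zeta9Model[g, y₀, θ]) :
    LinearMap.ker (thetaC θ) ≤
      Submodule.span ℂ {w : K3Index → ℂ | (∃ q : K3Index → ℚ, w = fun i => (q i : ℂ)) ∧ thetaC θ w = 0} := by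
  classical
  have hgint := hZ.2.1
  have hg9 : g ^ 9 = 1 := hZ.2.2.1
  have hker := ker_thetaC_eq_of_zeta9Model hZ
  intro w hw
  rw [hker, LinearMap.mem_ker, LinearMap.sub_apply, Module.End.one_apply, sub_eq_zero] at hw
  -- the projector onto the cube-fixed part
  set PN : Module.End ℂ (K3Index → ℂ) := (1 / 3 : ℂ) • (g ^ 6 + g ^ 3 + 1) with hPN
  have hPNw : PN w = w := by
    have h6 : (g ^ 6) w = w := by
      rw [show (6 : ℕ) = 3 + 3 by norm_num, pow_add, Module.End.mul_apply, hw, hw]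
    rw [hPN, LinearMap.smul_apply, LinearMap.add_apply, LinearMap.add_apply, Module.End.one_apply, h6, hw]
    module
  -- `PN eᵢ` is a rational vector of `ker θ_ℂ`
  have hPNker : ∀ z, thetaC θ (PN z) = 0 := by
    intro z
    have hop : (g ^ 3 - 1) * PN = 0 := by
      have hpoly : ((X ^ 3 - 1) * (X ^ 6 + X ^ 3 + 1) : ℂ[X]) = X ^ 9 - 1 := by ring
      have h := congrArg (Polynomial.aeval g) hpoly
      simp only [map_mul, map_sub, map_add, map_pow, Polynomial.aeval_X, map_one] at h
      rw [hg9, sub_self] at h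
      rw [hPN, mul_smul_comm, h, smul_zero]
    have hmem : PN z ∈ LinearMap.ker (g ^ 3 - 1) := by
      rw [LinearMap.mem_ker, ← Module.End.mul_apply, hop, LinearMap.zero_apply]
    rw [← hker] at hmem
    exact hmem
  have hPNrat : ∀ i : K3Index, ∃ q : K3Index → ℚ, PN (Pi.single i 1) = fun j => (q j : ℂ) := by
    intro i
    have hcast : (Pi.single i (1 : ℂ) : K3Index → ℂ) = fun j => ((Pi.single i (1 : ℤ) : K3Index → ℤ) j : ℂ) := by
      funext j
      by_cases hij : j = i
      · subst hij; simp
      · simp [hij]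
    obtain ⟨w6, hw6⟩ := pow_apply_intCast_of_intCast hgint 6 (Pi.single i 1)
    obtain ⟨w3, hw3⟩ := pow_apply_intCast_of_intCast hgint 3 (Pi.single i 1)
    refine ⟨fun j => (1 / 3 : ℚ) * ((w6 j + w3 j + (Pi.single i (1 : ℤ) : K3Index → ℤ) j : ℤ) : ℚ), ?_⟩
    rw [hcast, hPN, LinearMap.smul_apply, LinearMap.add_apply, LinearMap.add_apply, Module.End.one_apply,
      hw6, hw3]
    funext j
    simp only [Pi.smul_apply, Pi.add_apply, smul_eq_mul]
    push_cast
    ring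
  -- decompose `w = PN w = Σ wᵢ PN eᵢ`
  have hdecomp : w = ∑ i, w i • PN (Pi.single i 1) := by
    conv_lhs => rw [← hPNw, ← Finset.univ_sum_single w]
    rw [map_sum]
    refine Finset.sum_congr rfl fun i _ => ?_
    rw [← map_smul]
    congr 1
    funext j
    simp [Pi.single_apply]
  rw [hdecomp]
  refine Submodule.sum_mem _ fun i _ => Submodule.smul_mem _ _ (Submodule.subset_span ?_)
  obtain ⟨q, hq⟩ := hPNrat i
  exact ⟨⟨q, hq⟩, hPNker _⟩

/-- **A K3 surface of the ζ₉ rational real-multiplication type has Picard number `10`.** For a marked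
projective K3 surface `(S, η, p, x)` with an endomorphism `t` (type-preserving, killing `N¹(S)`) conjugate
by a rational isometry `σ` of `Λ_ℚ` to the ζ₉ model `θ_ℂ`: `ρ(S) = dim_ℂ N¹H²(S(ℂ); ℂ) = 10`. `ση` maps
`N¹(S)_ℂ` into `ker θ_ℂ` (as `t` kills `N¹`), and ONTO: `ker θ_ℂ` is spanned by rational vectors
(`ker_thetaC_le_span_ratCast`), each the image of an algebraic class
(`exists_mem_algebraicClasses_of_ratCast_mem_ker`); `dim ker θ_ℂ = 10`
(`finrank_ker_thetaC_of_zeta9Model`). Fact-free. [cite: GeemenSchutt2023, Thm. 1.1 (9) and §2.4]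
[cite: Huybrechts2016K3, Ch. 3 §3.2] -/
theorem finrank_algebraicClasses_eq_ten_of_zeta9Model (hZ : Zeta9Model[g, y₀, θ]) (hS : IsK3Surface S)
    (η : complexBetti S (2 * 1) ≃ₗ[ℂ] (K3Index → ℂ)) (p : complexBetti S (2 * 2)) (x : K3Index → ℂ)
    (hM : MarkedK3[S, η, p, x])
    (t : complexBetti S (2 * 1) →ₗ[ℂ] complexBetti S (2 * 1))
    (ht_typ : ∀ (i j : ℕ) (y : complexBetti S (2 * 1)),
      IsOfHodgeType 2 S (2 * 1) i j y → IsOfHodgeType 2 S (2 * 1) i j (t y))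
    (ht_N : ∀ d ∈ algebraicClasses S 1, t d = 0)
    (σ : Module.End ℂ (K3Index → ℂ)) (hσ : ∀ a b, k3Form (σ a) (σ b) = k3Form a b)
    (hσrat : ∀ v : K3Index → ℤ, ∃ w : K3Index → ℚ, σ (fun i => (v i : ℂ)) = fun i => (w i : ℂ))
    (hconj : ∀ c : complexBetti S (2 * 1), σ (η (t c)) = thetaC θ (σ (η c))) :
    Module.finrank ℂ ↥(algebraicClasses S 1) = 10 := by
  classical
  set A : complexBetti S (2 * 1) →ₗ[ℂ] (K3Index → ℂ) := σ ∘ₗ η.toLinearMap with hA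
  have hAapp : ∀ c, A c = σ (η c) := fun c => rfl
  have hσinj : Function.Injective σ := injective_of_k3Form_isometry σ hσ
  have hAinj : Function.Injective A := fun a b hab => η.injective (hσinj hab)
  set N := algebraicClasses S 1 with hNdef
  have hle : N.map A ≤ LinearMap.ker (thetaC θ) := by
    rintro w ⟨d, hd, rfl⟩
    rw [LinearMap.mem_ker, hAapp, ← hconj, ht_N d hd, map_zero, map_zero]
  have hge : LinearMap.ker (thetaC θ) ≤ N.map A := by
    refine (ker_thetaC_le_span_ratCast hZ).trans (Submodule.span_le.2 ?_)
    rintro w ⟨⟨q, rfl⟩, hq⟩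
    obtain ⟨d, hd, hdq⟩ := exists_mem_algebraicClasses_of_ratCast_mem_ker hZ hS η p x hM t ht_typ ht_N σ hσ
      hσrat hconj q hq
    exact ⟨d, hd, hdq⟩
  have heq : N.map A = LinearMap.ker (thetaC θ) := le_antisymm hle hge
  rw [LinearEquiv.finrank_eq (Submodule.equivMapOfInjective A hAinj N), heq]
  exact finrank_ker_thetaC_of_zeta9Model hZ

/-- **HC⁴(S ⊗ S) for every K3 surface of the ζ₉ real-multiplication type, from the conjugacy alone.**
THERE IS a ζ₉ datum `(g, y₀, θ)` (as supplied by `VanGeemenSchuett2025_zeta9_cycleOnOpenPeriodSet`) such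
that EVERY projective K3 surface `S`, marked by `(η, p, x)`, carrying an endomorphism `t` of `H²(S(ℂ); ℂ)`
— rational, Hodge-type preserving, killing `N¹H²`, with image cup-orthogonal to `N¹H²` — which is conjugate
to `θ_ℂ` by a RATIONAL ISOMETRY `σ` of `Λ_ℚ` (`σ(η(t c)) = θ_ℂ(σ(η c))`) satisfies
`HodgeConjectureFor 4 (S ⊗ S)`: `ρ(S) = 10` is forced (`finrank_algebraicClasses_eq_ten_of_zeta9Model`)
and `exists_zeta9Type_hodgeConjectureFor_square_of_picard_ten` applies (annihilating cubic and
generation-or-CM are then automatic). These `S` are exactly the K3 surfaces RM-isogenous to a member of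
the maximal ζ₉ family of van Geemen–Schütt. CONDITIONAL on {`Buskin2019_hodgeIsometry_algebraic`,
`VanGeemenSchuett2025_zeta9_cycleOnOpenPeriodSet`, `Huybrechts_K3_marking_exists`,
`Buskin2019_hodgeConjectureFor_square_of_CM`}; credits nothing; HC is NOT proved here.
[cite: GeemenSchutt2023, Thm. 1.1 (9), §4.8, §5.6] [cite: Vangeemen2008, Lemma 3.2]
[cite: Buskin2019, Thm. 1.1 and Corollary] [cite: Huybrechts2016K3, Ch. 3 §3.2 and Cor. 3.6] -/
theorem exists_zeta9Type_hodgeConjectureFor_square_of_conj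
    (hB : Buskin2019_hodgeIsometry_algebraic) (hV : VanGeemenSchuett2025_zeta9_cycleOnOpenPeriodSet)
    (hmark : Huybrechts_K3_marking_exists) (hCM : Buskin2019_hodgeConjectureFor_square_of_CM) :
    ∃ (g : Module.End ℂ (K3Index → ℂ)) (y₀ : K3Index → ℂ) (θ : Matrix K3Index K3Index ℚ),
      Zeta9Model[g, y₀, θ] ∧
      ∀ (S : SchemeOver ℂ) (_hS : IsK3Surface S)
        (η : complexBetti S (2 * 1) ≃ₗ[ℂ] (K3Index → ℂ)) (p : complexBetti S (2 * 2)) (x : K3Index → ℂ)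
        (_hM : MarkedK3[S, η, p, x])
        (t : complexBetti S (2 * 1) →ₗ[ℂ] complexBetti S (2 * 1))
        (_ht_rat : ∀ y, IsRationalClass y → IsRationalClass (t y))
        (_ht_typ : ∀ (i j : ℕ) (y : complexBetti S (2 * 1)),
          IsOfHodgeType 2 S (2 * 1) i j y → IsOfHodgeType 2 S (2 * 1) i j (t y))
        (_ht_N : ∀ d ∈ algebraicClasses S 1, t d = 0)
        (_ht_perp : ∀ (y : complexBetti S (2 * 1)), ∀ d ∈ algebraicClasses S 1,
          cupProduct (rfl : 2 * 1 + 2 * 1 = 2 * 2) (t y) d = 0)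
        (σ : Module.End ℂ (K3Index → ℂ)) (_hσ : ∀ a b, k3Form (σ a) (σ b) = k3Form a b)
        (_hσrat : ∀ v : K3Index → ℤ, ∃ w : K3Index → ℚ, σ (fun i => (v i : ℂ)) = fun i => (w i : ℂ))
        (_hconj : ∀ c : complexBetti S (2 * 1), σ (η (t c)) = thetaC θ (σ (η c))),
        HodgeConjectureFor 4 (S ⊗ S) := by
  obtain ⟨g, y₀, θ, hZ, h10⟩ := exists_zeta9Type_hodgeConjectureFor_square_of_picard_ten hB hV hmark hCM
  refine ⟨g, y₀, θ, hZ, ?_⟩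
  intro S hS η p x hM t ht_rat ht_typ ht_N ht_perp σ hσ hσrat hconj
  exact h10 S hS (finrank_algebraicClasses_eq_ten_of_zeta9Model hZ hS η p x hM t ht_typ ht_N σ hσ hσrat hconj)
    η p x hM t ht_rat ht_typ ht_N ht_perp σ hσ hσrat hconj

end Summit.HodgeConjecture.HodgeConjecture.Theorems.MarkmanPartnerTransport.RMTypeOrbit

end
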